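import Summits.QuantumFields.YangMills.Theorems.PoincareLipschitzGapOfHSystemGap
import Summits.QuantumFields.YangMills.Theorems.PoincareLipschitzHSystemGapAtThreePi
import HarnessLib

/-!
# Crux `BlockLipschitzL` (stmt-QuantumFields-23533) ∕ `HistoryTailL` (stmt-QuantumFields-19936), LINE 25 «CompactnessTransfer» —
# «GAP HOLDS»: THE `8π`∕`3π` ENERGY GAP OF MINIMIZING TANGENT MAPS `ℝ³ → S³`, HYPOTHESIS-FREE

Cell `ym3-torus` (YM ladder rung R3 = continuum SU(2) Yang–Mills on T³ — a RUNG, NOT Clay: not d = 4, not infinite volume,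
not a mass gap); WIDTH helper seat `ym3-torus-px19` g8 (ROAD (H) architect); `--supports stmt-QuantumFields-23533`; THEOREMS ONLY
(0 `def`, 0 `sorry`, default heartbeats); imports this seat's ✓`…GapOfHSystemGap` (ROAD (W)'s socket: (GAP) ⟸ (F′), over (Q-J), (Q)×2,
px5 g9's H8 `doorH_sq`, px14 g7 ∕ px16 g10's (T) door) and ★w3 g16's ✓`…HSystemGapAtThreePi` ((F′) = the `3π` energy gap of the
H-system `ΔB = 2B_x ∧ B_y`, HYPOTHESIS-FREE — ROAD (W): W-ALG∕W-KNIT ★w3 g16, W-EN px3 g10, W-WIR px6 g10, W-ONE w7 g15, W-INV w4 g16,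
W-TWO∕W-DEC px22 g8, over this seat's (Q-J) `integral_mul_jacobian`).

WHAT THIS FILE PROVES.  ★★★★ `gap_holds : ⟨(GAP)⟩` — px3 g9's FROZEN (GAP) binder text (sha16 30a3f4556be5a68a; the one hypothesis of
✓`PoincareLipschitzTangentMapDensityCapHolds.uniformSmallScaleEnergy_band_of_gap` = registered S1″, and of LEAD's ✓`blockLipschitzL_of_gap`)
WITH NO HYPOTHESIS: «a finite-energy unit `W^{1,2}` map `Q → S³ ⊂ ℝ⁴` minimising on balls, whose central ball energies are linear
`E(B_r(0)) = Θ·r` (`r ≤ 1∕2`) with `Θ ≤ 3π`, has `Θ = 0`».  With px3 g9's ✓`centralDensity_le_three_pi_holds` (EVERY minimizing tangent map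
has `Θ ≤ 3π`) this is [SchoenUhlenbeck1984, Prop. 1.2] «minimizing tangent maps `ℝ³ → S³` are constant» for the cell's class, proved
WITHOUT SU82 partial regularity, WITHOUT [SU84 Lemma 1.1], WITHOUT Hélein: stability + Hardy (px3), `SU(2)` currents ⇒ H-system
(px19), cone → plane transport (px14∕px16∕px19), planar stream functions (px5), and the sharp two-point Wente bound at exactly `3π` (ROAD (W)).
HONEST SCOPE.  (GAP) is proved; S1″ follows by px3's door (filed next as the registered STUB alias) and `BlockLipschitzL` by LEAD's
`blockLipschitzL_of_gap` (LEAD's close); K1-exp, `MeanDeviationL`∕(Q), `HistoryTailL` are NOT proved here.  YM₃ on T³ is rung R3, not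
Clay; YM gap NOT proved; no summit statement is proved here.

References: R. Schoen, K. Uhlenbeck, Invent. Math. 78 (1984) 89–100 [SchoenUhlenbeck1984] (Prop. 1.2, Lemma 1.1); H. Brezis, J.-M. Coron,
Arch. Rational Mech. Anal. 89 (1985) [BrezisCoron1985]; H. C. Wente (1969); P. Topping (1997) (sharp constant `1∕2π`).
-/

set_option autoImplicit false

noncomputable section

open MeasureTheory Set Function Filter Topology Metric TopologicalSpace
open scoped ContDiff ENNReal BigOperators RealInnerProductSpace

namespace Summit.QuantumFields.YangMills.Theorems.PoincareLipschitzGapHolds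

open Literature.Analysis.FunctionSpaces
open Summit.QuantumFields.YangMills.Theorems.PoincareLipschitzGapOfHSystemGap (gap_of_hSystemGap)

/-- ★★★★ **GAP HOLDS — the `8π` energy gap of minimizing tangent maps `ℝ³ → S³` at the `3π` cap, hypothesis-free** (TYPE = px3 g9's
(GAP) binder 30a3f4556be5a68a VERBATIM): ROAD (H)'s socket ✓`gap_of_hSystemGap` fed with ROAD (W)'s hypothesis-free (F′)
✓`PoincareLipschitzHSystemGapAtThreePi.hSystem_energy_zero_of_le_three_pi`. [cite: SchoenUhlenbeck1984, Proposition 1.2 and Lemma 1.1; BrezisCoron1985, Appendix, Lemma A.1] -/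
theorem gap_holds :
    ∀ (hQ : IsOpen {x : EuclideanSpace ℝ (Fin 3) | ∀ i : Fin 3, |x i| < 1}) (U : EuclideanSpace ℝ (Fin 3) → EuclideanSpace ℝ (Fin 4)) (G : EuclideanSpace ℝ (Fin 3) → (EuclideanSpace ℝ (Fin 3) →L[ℝ] EuclideanSpace ℝ (Fin 4))),
      (HasWeakFDerivOn ⟨{x : EuclideanSpace ℝ (Fin 3) | ∀ i : Fin 3, |x i| < 1}, hQ⟩ volume U G ∧
        (∀ x : EuclideanSpace ℝ (Fin 3), (∀ i : Fin 3, |x i| < 1) → ‖U x‖ = 1) ∧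
        IntegrableOn (fun x => ∑ i : Fin 3, ‖G x (EuclideanSpace.single i (1:ℝ))‖ ^ 2) {x : EuclideanSpace ℝ (Fin 3) | ∀ i : Fin 3, |x i| < 1} ∧
        (∀ (y : EuclideanSpace ℝ (Fin 3)) (ρ : ℝ), 0 < ρ → closedBall y ρ ⊆ {x : EuclideanSpace ℝ (Fin 3) | ∀ i : Fin 3, |x i| < 1} →
          ∀ (W : EuclideanSpace ℝ (Fin 3) → EuclideanSpace ℝ (Fin 4)) (GW : EuclideanSpace ℝ (Fin 3) → (EuclideanSpace ℝ (Fin 3) →L[ℝ] EuclideanSpace ℝ (Fin 4))),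
          HasWeakFDerivOn ⟨{x : EuclideanSpace ℝ (Fin 3) | ∀ i : Fin 3, |x i| < 1}, hQ⟩ volume W GW →
          (∀ x : EuclideanSpace ℝ (Fin 3), (∀ i : Fin 3, |x i| < 1) → ‖W x‖ = 1) →
          IntegrableOn (fun x => ∑ i : Fin 3, ‖GW x (EuclideanSpace.single i (1:ℝ))‖ ^ 2) {x : EuclideanSpace ℝ (Fin 3) | ∀ i : Fin 3, |x i| < 1} →
          (∃ ρ' : ℝ, ρ' < ρ ∧ ∀ x : EuclideanSpace ℝ (Fin 3), x ∉ ball y ρ' → W x = U x) →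
          ∫ x in ball y ρ, ∑ i : Fin 3, ‖G x (EuclideanSpace.single i (1:ℝ))‖ ^ 2 ≤ ∫ x in ball y ρ, ∑ i : Fin 3, ‖GW x (EuclideanSpace.single i (1:ℝ))‖ ^ 2)) →
      ∀ Θ : ℝ, (∀ r : ℝ, 0 < r → r ≤ 1 / 2 → ∫ x in ball (0 : EuclideanSpace ℝ (Fin 3)) r, ∑ i : Fin 3, ‖G x (EuclideanSpace.single i (1:ℝ))‖ ^ 2 = Θ * r) →
        Θ ≤ 3 * Real.pi → Θ = 0 :=
  gap_of_hSystemGap fun _ _ hB hB2 hE hH hΘ =>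
    Summit.QuantumFields.YangMills.Theorems.PoincareLipschitzHSystemGapAtThreePi.hSystem_energy_zero_of_le_three_pi
      hB hB2 hE hH hΘ

end Summit.QuantumFields.YangMills.Theorems.PoincareLipschitzGapHolds
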